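import Literature.Probability.RandomPlanarGeometry.SelfAvoidingWalk
import Literature.Probability.LatticeModels.RandomWalkLoopMeasure
import HarnessLib

/-!
# Gluing self-avoiding walks — support file for `stub_sawDomainMarkov`
(line `capacity-clock-no-plateau` of the crux `SAWLoopFugacityFlow.SimpleSubseqLimits`,
stmt-CriticalPhenomena-4982, STUB 3c; registered skeleton
`Summits/CriticalPhenomena/SAWScalingLimit/Cruxes/SimpleSubseqLimits/CapacityClockNoPlateau`)

Generic walk bookkeeping for the exact domain Markov property of the critical two-point SAW law
`P(γ) ∝ x_c^{|γ|}` (`SAW.law`, `SelfAvoidingWalk.lean`), for two discrete domains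
`Ω'_δ ≤ Ω_δ` on `δℤ²` and a prefix path `pw : a → t` of `Ω_δ`:

* `glue` — concatenation `η ↦ pw ++ η` of the prefix with a SAW `η : t → b` of `Ω'_δ`
  (Madras–Slade 1993, §1.2), a SAW of `Ω_δ` as soon as the tails of such `η` avoid `pw`;
  it is injective (`glue_injective`), lengths add (`length_glue`), the glued walk has prefix
  `pw` (`take_support_glue`) and its remaining polyline is the polyline of `η`
  (`curve_drop_glue`); conversely every SAW with prefix `pw` whose remaining edges are edges of
  `Ω'_δ` is glued (`exists_glue_eq`) — everything is read off the support lists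
  (`SimpleGraph.Walk.ext_support`);
* `prefixWalk` — the prefix of a SAW realising the event {first `K + 1` vertices `= p`} as a
  path `a → t` with support `p`;
* `weight_apply_tsum` — `SAW.weight` of a set as a `tsum` of the weights `x_c^{|γ|}`.

No named facts. Sources: N. Madras, G. Slade, *The Self-Avoiding Walk* (1993), §1.2;
G. F. Lawler, O. Schramm, W. Werner (2004), §3.1.
-/

noncomputable section

open MeasureTheory Filter Topology Set
open Literature.Probability.RandomPlanarGeometry Literature.Probability.LatticeModels
open scoped ENNReal NNReal unitInterval

namespace Summit.CriticalPhenomena.SAWScalingLimit.Theorems.SimpleSubseqLimits.CapacityClock.DomainMarkov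

variable {δ : ℝ}

/-! ### Gluing a prefix to the self-avoiding walks of a smaller discrete domain -/

section Glue

variable {Ω Ω' : Set ℂ} {a b t : Site 2}

variable (pw : (discreteDomainGraph Ω δ).Walk a t) (hpw : pw.IsPath)
  (hle : discreteDomainGraph Ω' δ ≤ discreteDomainGraph Ω δ)
  (hav : ∀ (η : SAW.DomainSAW Ω' δ t b), ∀ x ∈ η.walk.support.tail, x ∉ pw.support)

/-- **Gluing**: the prefix path `pw : a → t` of `Ω_δ` followed by a SAW `η : t → b` of the smaller
domain `Ω'_δ ≤ Ω_δ`, a SAW of `Ω_δ` from `a` to `b` as soon as the tails of such `η` avoid `pw`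
(Madras–Slade 1993, §1.2: concatenation). [folklore] -/
def glue (η : SAW.DomainSAW Ω' δ t b) : SAW.DomainSAW Ω δ a b :=
  ⟨pw.append (η.walk.mapLe hle), by
    rw [SimpleGraph.Walk.isPath_def, SimpleGraph.Walk.support_append,
      SimpleGraph.Walk.support_mapLe_eq_support, List.nodup_append]
    refine ⟨(SimpleGraph.Walk.isPath_def _).1 hpw,
      ((SimpleGraph.Walk.isPath_def _).1 η.isPath).sublist (List.tail_sublist _), ?_⟩
    intro x hx y hy hxy
    subst hxy
    exact hav η x hy hx⟩

/-- The walk of a glued SAW. [folklore] -/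
@[simp] theorem walk_glue (η : SAW.DomainSAW Ω' δ t b) :
    (glue pw hpw hle hav η).walk = pw.append (η.walk.mapLe hle) := rfl

/-- The support of a glued SAW: the prefix without its tip, then the suffix. [folklore] -/
theorem support_glue (η : SAW.DomainSAW Ω' δ t b) :
    (glue pw hpw hle hav η).walk.support = pw.support.dropLast ++ η.walk.support := by
  rw [walk_glue, SimpleGraph.Walk.support_append_eq_support_dropLast_append,
    SimpleGraph.Walk.support_mapLe_eq_support]

/-- The support of a glued SAW: the prefix, then the tail of the suffix. [folklore] -/
theorem support_glue' (η : SAW.DomainSAW Ω' δ t b) :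
    (glue pw hpw hle hav η).walk.support = pw.support ++ η.walk.support.tail := by
  rw [walk_glue, SimpleGraph.Walk.support_append, SimpleGraph.Walk.support_mapLe_eq_support]

/-- Lengths add under gluing. [folklore] -/
theorem length_glue (η : SAW.DomainSAW Ω' δ t b) :
    (glue pw hpw hle hav η).length = pw.length + η.length := by
  have hmap : (η.walk.mapLe hle).length = η.walk.length := by
    unfold SimpleGraph.Walk.mapLe
    exact SimpleGraph.Walk.length_map _ _
  simp only [SAW.DomainSAW.length, walk_glue, SimpleGraph.Walk.length_append, hmap]

/-- Gluing is injective. [folklore] -/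
theorem glue_injective : Function.Injective (glue (b := b) pw hpw hle hav) := by
  intro η₁ η₂ h
  have h' := congrArg (fun γ : SAW.DomainSAW Ω δ a b => γ.walk.support) h
  simp only [support_glue] at h'
  exact SAW.DomainSAW.eq_of_walk_eq (SimpleGraph.Walk.ext_support (List.append_cancel_left h'))

/-- A glued SAW has the prefix `pw`. [folklore] -/
theorem take_support_glue {k : ℕ} (hk : pw.length = k) (η : SAW.DomainSAW Ω' δ t b) :
    (glue pw hpw hle hav η).walk.support.take (k + 1) = pw.support := by
  subst hk
  rw [support_glue', List.take_left' (pw.length_support)]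

/-- The remaining walk of a glued SAW has the support of the suffix. [folklore] -/
theorem support_drop_glue {k : ℕ} (hk : pw.length = k) (η : SAW.DomainSAW Ω' δ t b) :
    ((glue pw hpw hle hav η).walk.drop k).support = η.walk.support := by
  subst hk
  rw [SimpleGraph.Walk.drop_support_eq_support_drop_min]
  have hlen : (glue pw hpw hle hav η).walk.length = pw.length + η.length :=
    length_glue pw hpw hle hav η
  rw [hlen, Nat.min_eq_left (Nat.le_add_right _ _), support_glue]
  exact List.drop_left' (by rw [List.length_dropLast, SimpleGraph.Walk.length_support]; rfl)

/-- The remaining polyline of a glued SAW is the polyline of the suffix. [folklore] -/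
theorem curve_drop_glue {k : ℕ} (hk : pw.length = k) (η : SAW.DomainSAW Ω' δ t b) :
    CurveClass.mk ⟨((glue pw hpw hle hav η).walk.drop k).toCurve (meshPoint δ)⟩ = η.curve := by
  rw [SAW.DomainSAW.curve]
  unfold SimpleGraph.Walk.toCurve
  rw [support_drop_glue pw hpw hle hav hk]

/-- **Every SAW with prefix `pw` whose remaining edges lie in `Ω'_δ` is glued.** [folklore] -/
theorem exists_glue_eq {k : ℕ} (hk : pw.length = k) (γ : SAW.DomainSAW Ω δ a b)
    (hγ : γ.walk.support.take (k + 1) = pw.support)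
    (hR : ∀ e ∈ (γ.walk.drop k).edges, e ∈ (discreteDomainGraph Ω' δ).edgeSet) :
    ∃ η, glue pw hpw hle hav η = γ := by
  subst hk
  have hlen : pw.length ≤ γ.walk.length := by
    have h := congrArg List.length hγ
    rw [List.length_take, SimpleGraph.Walk.length_support, SimpleGraph.Walk.length_support] at h
    omega
  have hK : γ.walk.getVert pw.length = t := by
    have h1 := SimpleGraph.Walk.getVert_eq_support_getElem? γ.walk hlen
    have h2 := SimpleGraph.Walk.getVert_eq_support_getElem? pw le_rfl
    rw [SimpleGraph.Walk.getVert_length, ← hγ, List.getElem?_take, if_pos (Nat.lt_succ_self _),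
      ← h1] at h2
    exact (Option.some_injective _ h2).symm
  set ηw := (γ.walk.drop pw.length).copy hK rfl with hηw
  have hηw_supp : ηw.support = γ.walk.support.drop pw.length := by
    rw [hηw, SimpleGraph.Walk.support_copy, SimpleGraph.Walk.drop_support_eq_support_drop_min,
      Nat.min_eq_left hlen]
  have hR' : ∀ e ∈ ηw.edges, e ∈ (discreteDomainGraph Ω' δ).edgeSet := by
    rw [hηw, SimpleGraph.Walk.edges_copy]; exact hR
  refine ⟨⟨ηw.transfer _ hR', ?_⟩, ?_⟩
  · rw [SimpleGraph.Walk.isPath_def, SimpleGraph.Walk.support_transfer, hηw_supp]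
    exact ((SimpleGraph.Walk.isPath_def _).1 γ.isPath).sublist (List.drop_sublist _ _)
  · apply SAW.DomainSAW.eq_of_walk_eq
    apply SimpleGraph.Walk.ext_support
    rw [support_glue', SimpleGraph.Walk.support_transfer, hηw_supp, ← hγ, List.tail_drop,
      List.take_append_drop]

end Glue

/-! ### Walk bookkeeping -/

/-- Every vertex in the tail of the support of a walk is the head of one of its darts.
[folklore] -/
theorem exists_adj_of_mem_support_tail {V : Type*} {G : SimpleGraph V} :
    ∀ {u v : V} (w : G.Walk u v) {x : V}, x ∈ w.support.tail → ∃ y, G.Adj y x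
  | _, _, .nil, _, hx => by simp at hx
  | _, _, .cons h q, x, hx => by
    rw [SimpleGraph.Walk.support_cons, List.tail_cons] at hx
    rcases (SimpleGraph.Walk.mem_support_iff q).1 hx with rfl | hx'
    · exact ⟨_, h⟩
    · exact exists_adj_of_mem_support_tail q hx'

/-- If a vertex set contains the first endpoint of every edge, a walk ending in it stays in it.
[folklore] -/
theorem support_subset_of_adj_closed {V : Type*} {G : SimpleGraph V} {T : Set V}
    (hT : ∀ ⦃x y : V⦄, G.Adj x y → x ∈ T) :
    ∀ {u v : V} (w : G.Walk u v), v ∈ T → ∀ x ∈ w.support, x ∈ T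
  | _, _, .nil, hv, x, hx => by
    rw [SimpleGraph.Walk.support_nil, List.mem_singleton] at hx
    exact hx ▸ hv
  | _, _, .cons h q, hv, x, hx => by
    rw [SimpleGraph.Walk.support_cons, List.mem_cons] at hx
    rcases hx with rfl | hx
    · exact hT h
    · exact support_subset_of_adj_closed hT q hv x hx

/-- A walk whose first `K + 1` vertices are the list `p` (of length `K + 1`, last entry `t`) has
length `≥ K` and passes through `t` at time `K`. [folklore] -/
theorem getVert_eq_of_take_eq {V : Type*} {G : SimpleGraph V} {u v : V} (w : G.Walk u v)
    {p : List V} {K : ℕ} {t : V} (hpK : p.length = K + 1) (hpt : p.getLast? = some t)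
    (hw : w.support.take (K + 1) = p) : K ≤ w.length ∧ w.getVert K = t := by
  have hlen : K ≤ w.length := by
    have h := congrArg List.length hw
    rw [List.length_take, SimpleGraph.Walk.length_support, hpK] at h
    omega
  refine ⟨hlen, ?_⟩
  have h1 := SimpleGraph.Walk.getVert_eq_support_getElem? w hlen
  rw [List.getLast?_eq_getElem?, hpK, Nat.add_sub_cancel, ← hw, List.getElem?_take,
    if_pos (Nat.lt_succ_self K), ← h1] at hpt
  exact Option.some_injective _ hpt

/-! ### The prefix walk -/

section Prefix

variable {a b t : Site 2} {p : List (Site 2)} {K : ℕ}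

/-- The prefix of a SAW `γ₀` realising the prefix event, as a walk from `a` to the tip `t`.
[folklore] -/
def prefixWalk {Ω : Set ℂ} (γ₀ : SAW.DomainSAW Ω δ a b) (hpK : p.length = K + 1)
    (hpt : p.getLast? = some t) (hγ₀ : γ₀.walk.support.take (K + 1) = p) :
    (discreteDomainGraph Ω δ).Walk a t :=
  (γ₀.walk.take K).copy rfl (getVert_eq_of_take_eq γ₀.walk hpK hpt hγ₀).2

/-- The prefix walk has support `p`. [folklore] -/
theorem support_prefixWalk {Ω : Set ℂ} (γ₀ : SAW.DomainSAW Ω δ a b) (hpK : p.length = K + 1)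
    (hpt : p.getLast? = some t) (hγ₀ : γ₀.walk.support.take (K + 1) = p) :
    (prefixWalk γ₀ hpK hpt hγ₀).support = p := by
  rw [prefixWalk, SimpleGraph.Walk.support_copy, SimpleGraph.Walk.support_take, hγ₀]

/-- The prefix walk has length `K`. [folklore] -/
theorem length_prefixWalk {Ω : Set ℂ} (γ₀ : SAW.DomainSAW Ω δ a b) (hpK : p.length = K + 1)
    (hpt : p.getLast? = some t) (hγ₀ : γ₀.walk.support.take (K + 1) = p) :
    (prefixWalk γ₀ hpK hpt hγ₀).length = K := by
  rw [prefixWalk, SimpleGraph.Walk.length_copy, SimpleGraph.Walk.take_length,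
    Nat.min_eq_left (getVert_eq_of_take_eq γ₀.walk hpK hpt hγ₀).1]

/-- The prefix walk is a path. [folklore] -/
theorem isPath_prefixWalk {Ω : Set ℂ} (γ₀ : SAW.DomainSAW Ω δ a b) (hpK : p.length = K + 1)
    (hpt : p.getLast? = some t) (hγ₀ : γ₀.walk.support.take (K + 1) = p) :
    (prefixWalk γ₀ hpK hpt hγ₀).IsPath := by
  rw [SimpleGraph.Walk.isPath_def, support_prefixWalk, ← hγ₀]
  exact ((SimpleGraph.Walk.isPath_def _).1 γ₀.isPath).sublist (List.take_sublist _ _)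

end Prefix

/-! ### Weights -/

section Weights

variable {a b : Site 2}

-- adapted from Summits/CriticalPhenomena/SAWScalingLimit/Cruxes/SubseqIdentification/Disproof.lean
/-- The critical SAW measure of a set: the sum of the weights `x_c^{|γ|}` over the set.
[folklore] -/
theorem weight_apply_tsum {Ω : Set ℂ} (T : Set (SAW.DomainSAW Ω δ a b)) :
    SAW.weight Ω δ a b T = ∑' γ : SAW.DomainSAW Ω δ a b,
      T.indicator (fun γ => ENNReal.ofReal (SAW.criticalFugacity ^ γ.length)) γ := by
  rw [SAW.weight, Measure.sum_apply _ MeasurableSpace.measurableSet_top]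
  refine tsum_congr fun γ => ?_
  rw [Measure.smul_apply, smul_eq_mul, Measure.dirac_apply' _ MeasurableSpace.measurableSet_top]
  by_cases hγ : γ ∈ T
  · simp [hγ]
  · simp [hγ]

end Weights

/-- **Registered support stub `stub_sawDomainMarkov_walks` of `stub_sawDomainMarkov`**: every SAW
of `Ω_δ` with prefix `pw` whose remaining edges are edges of `Ω'_δ` is glued
(`exists_glue_eq`, closed form). [folklore] -/
theorem stub_sawDomainMarkov_walks :
    ∀ (Ω Ω' : Set ℂ) (δ : ℝ) (a b t : Site 2) (pw : (discreteDomainGraph Ω δ).Walk a t)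
      (hpw : pw.IsPath) (hle : discreteDomainGraph Ω' δ ≤ discreteDomainGraph Ω δ)
      (hav : ∀ (η : SAW.DomainSAW Ω' δ t b), ∀ x ∈ η.walk.support.tail, x ∉ pw.support)
      (γ : SAW.DomainSAW Ω δ a b), γ.walk.support.take (pw.length + 1) = pw.support →
      (∀ e ∈ (γ.walk.drop pw.length).edges, e ∈ (discreteDomainGraph Ω' δ).edgeSet) →
      ∃ η, glue pw hpw hle hav η = γ :=
  fun _ _ _ _ _ _ pw hpw hle hav γ hγ hR => exists_glue_eq pw hpw hle hav rfl γ hγ hR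

end Summit.CriticalPhenomena.SAWScalingLimit.Theorems.SimpleSubseqLimits.CapacityClock.DomainMarkov
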